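import Summits.QuantumFields.YangMills.Theorems.SwapVirialDeficitSectorLaplaceTipMidShellIntegration
import HarnessLib

/-!
# Route `SwapVirialDeficit` (YangMills): THE `δ`-INTEGRATION LAYER OF T-N6b, ISOTROPIC TWIN — shell weight `((1+δ²)⁻¹)²` without the soft-pair gain
# (cell ym-idea-1, skeleton ➎ v14, `stub_core_tip`; requested by w2 g61 2026-09-01T00:58Z for the p-UNIFORM matching against the isotropic rescaled floor
# ✓`mbDensity_ge_detFol_rescaled′` (ends included, no soft pair on the shell side); free-hands support of ⟨stmt-QuantumFields-24197⟩ `SwapVirialDeficit.SwapGluedStiffness`)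

Twin of ✓`tipMid_le_shell_of_pointwise` for a pointwise law WITHOUT the shell letter on the left: `F(δt) ≤ R·(1+δt²)·F(δs)` (`δt ∈ Mid ⊆ Ioi δ₁`, `δs ∈ Icc a c`, `c ≤ δ₁`).
Averaging over `δs` against the bare tip weight `((1+δs²)⁻¹)²` (exact mass `W′ = (c/(1+c²) − a/(1+a²) + arctan c − arctan a)/2`, antiderivative `(x/(1+x²) + arctan x)/2`) and
integrating `δt` against `(1+δt²)⁻¹` (mass `≤ δ₁⁻¹`):
* `hasDerivAt_sqInv_primitive`, `integral_Icc_inv_one_add_sq_sq` (the exact `W′`), `integral_Icc_inv_one_add_sq_sq_ge` (`W′ ≥ (a⁻³ − c⁻³)/12` for `1 ≤ a`);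
* ★★ `integral_mid_le_shell_of_pointwise'` (abstract `F ≥ 0`), ★★ `tipMid_le_shell_of_pointwise'` (`F(δ) = ∫_{Box}𝔪(hubAt δ 1, ε, ·)`):
  `∫_{Mid}((1+δ²)⁻¹)²F ≤ R/(δ₁·W′)·∫_{Icc a c}((1+δ²)⁻¹)²F`.
With `a = δ_r`, `c = δ_τ = δ₁ ≍ τ^{−1/2}`: `W′ ≍ 1/(12δ_r³)`, share `≍ 12δ_r³·R·√τ` — a pure `√τ`-rate since `δ_r = poly(L)` (w2 g61).

HONEST LABEL: real analysis; the pointwise law (w2 g61 ✓∕⧗`mbDensity_hubAt_comparable_rescaled` ∕ `_profile`), tip-core, thresholds and g49's plug remain; `stub_core_tip`,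
⟨24197⟩ ∕ ⟨24194⟩ OPEN; own crux ⟨22884⟩ `LargeFieldMassRefinementTail` OPEN (blocked-on ⟨19935⟩); the Yang–Mills mass gap is NOT proved; no summit is proved by a line.
THEOREMS ONLY (0 `def`, 0 `sorry`, no instance), standard axioms.  Width seat ym-line-sfw-p2-w3 g68 (cell ym-idea-1, free hands), `--supports stmt-QuantumFields-24197`.
References: [folklore].
-/

set_option autoImplicit false
set_option synthInstance.maxSize 1024

noncomputable section

open MeasureTheory Quaternion Set Filter
open scoped Quaternion BigOperators ENNReal Topology
open Literature.MathematicalPhysics.QuantumLattice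
open Literature.MathematicalPhysics.QuantumFieldTheory hiding SU2
open Summit.QuantumFields.YangMills.Theorems.SwapTwistDeficit.ToronLog

namespace Summit.QuantumFields.YangMills.Theorems.SwapVirialDeficit.SectorLaplace

open Summit.QuantumFields.YangMills.Theorems.FemtoTransferGap
open Summit.QuantumFields.YangMills.Theorems.FemtoTransferGap.TT
open Summit.QuantumFields.YangMills.Theorems.VirialFluxGap.RingDeficit
open Summit.QuantumFields.YangMills.Theorems.SwapVirialDeficit.SwapRing
open Summit.QuantumFields.YangMills.Theorems.SwapVirialDeficit.BlowUpRing

variable {L : ℕ} [NeZero L]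

/-! ## §1 The bare tip weight on the shell: exact mass and a floor -/

omit [NeZero L] in
/-- `d/dx [(x/(1+x²) + arctan x)/2] = ((1+x²)⁻¹)²`. [folklore] -/
theorem hasDerivAt_sqInv_primitive (x : ℝ) :
    HasDerivAt (fun x : ℝ => (x / (1 + x ^ 2) + Real.arctan x) / 2) (((1 + x ^ 2)⁻¹) ^ 2) x := by
  have hpos : (1 + x ^ 2) ≠ 0 := by positivity
  have h1 : HasDerivAt (fun x : ℝ => 1 + x ^ 2) (2 * x) x := by
    have h := (hasDerivAt_pow 2 x).const_add 1
    simpa using h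
  have h2 : HasDerivAt (fun x : ℝ => x / (1 + x ^ 2)) ((1 * (1 + x ^ 2) - x * (2 * x)) / (1 + x ^ 2) ^ 2) x := (hasDerivAt_id' x).div h1 hpos
  have h3 : HasDerivAt Real.arctan (1 / (1 + x ^ 2)) x := Real.hasDerivAt_arctan x
  have h := (h2.add h3).div_const 2
  refine h.congr_deriv ?_
  field_simp
  ring

omit [NeZero L] in
/-- `∫_{Icc a c} ((1+x²)⁻¹)² dx = (c/(1+c²) − a/(1+a²) + (arctan c − arctan a))/2` for `a ≤ c`. [folklore] -/
theorem integral_Icc_inv_one_add_sq_sq {a c : ℝ} (hac : a ≤ c) :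
    ∫ x in Icc a c, ((1 + x ^ 2)⁻¹) ^ 2 = (c / (1 + c ^ 2) - a / (1 + a ^ 2) + (Real.arctan c - Real.arctan a)) / 2 := by
  rw [integral_Icc_eq_integral_Ioc, ← intervalIntegral.integral_of_le hac]
  have hinv : Continuous fun x : ℝ => (1 + x ^ 2)⁻¹ :=
    Continuous.inv₀ (f := fun x : ℝ => 1 + x ^ 2) (by fun_prop) (fun x => by show (1 + x ^ 2 : ℝ) ≠ 0; positivity)
  have hcont : ContinuousOn (fun x : ℝ => ((1 + x ^ 2)⁻¹) ^ 2) (uIcc a c) := (hinv.pow 2).continuousOn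
  rw [intervalIntegral.integral_eq_sub_of_hasDerivAt (fun x _ => hasDerivAt_sqInv_primitive x) hcont.intervalIntegrable]
  ring

omit [NeZero L] in
/-- The floor `∫_{Icc a c} ((1+x²)⁻¹)² dx ≥ (a⁻³ − c⁻³)/12` for `1 ≤ a ≤ c` (`(1+x²)² ≤ 4x⁴` on `x ≥ 1`, antiderivative `−x⁻³/3`). [folklore] -/
theorem integral_Icc_inv_one_add_sq_sq_ge {a c : ℝ} (ha : 1 ≤ a) (hac : a ≤ c) :
    (a⁻¹ ^ 3 - c⁻¹ ^ 3) / 12 ≤ ∫ x in Icc a c, ((1 + x ^ 2)⁻¹) ^ 2 := by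
  have hinv : Continuous fun x : ℝ => (1 + x ^ 2)⁻¹ :=
    Continuous.inv₀ (f := fun x : ℝ => 1 + x ^ 2) (by fun_prop) (fun x => by show (1 + x ^ 2 : ℝ) ≠ 0; positivity)
  -- compare with `x⁻⁴/4` on `Icc a c`
  have hle : ∀ x ∈ Icc a c, x⁻¹ ^ 4 / 4 ≤ ((1 + x ^ 2)⁻¹) ^ 2 := by
    intro x hx
    have hx1 : 1 ≤ x := ha.trans hx.1
    have hx0 : 0 < x := by linarith
    have hx2 : 1 ≤ x ^ 2 := by nlinarith
    have h4 : (1 + x ^ 2) ^ 2 ≤ 4 * x ^ 4 := by nlinarith [mul_nonneg (by positivity : (0 : ℝ) ≤ 3 * x ^ 2 + 1) (sub_nonneg.2 hx2)]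
    have e1 : x⁻¹ ^ 4 / 4 = 1 / (4 * x ^ 4) := by rw [inv_pow]; field_simp
    have e2 : ((1 + x ^ 2)⁻¹) ^ 2 = 1 / (1 + x ^ 2) ^ 2 := by rw [inv_pow, one_div]
    rw [e1, e2]
    exact one_div_le_one_div_of_le (by positivity) h4
  have hprim : ∀ x ∈ uIcc a c, HasDerivAt (fun x : ℝ => -(x⁻¹ ^ 3) / 12) (x⁻¹ ^ 4 / 4) x := by
    intro x hx
    rw [uIcc_of_le hac] at hx
    have hx0 : x ≠ 0 := by linarith [ha.trans hx.1]
    have h1 : HasDerivAt (fun x : ℝ => x⁻¹) (-(x ^ 2)⁻¹) x := hasDerivAt_inv hx0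
    have h2 := ((h1.pow 3).neg).div_const 12
    refine h2.congr_deriv ?_
    simp only [inv_pow]
    field_simp
    ring
  have hcont4 : ContinuousOn (fun x : ℝ => x⁻¹ ^ 4 / 4) (uIcc a c) := by
    refine ContinuousOn.div_const (ContinuousOn.pow (continuousOn_inv₀.mono ?_) 4) 4
    intro x hx
    rw [uIcc_of_le hac] at hx
    exact ne_of_gt (by linarith [ha.trans hx.1])
  have hI4 : ∫ x in Icc a c, x⁻¹ ^ 4 / 4 = (a⁻¹ ^ 3 - c⁻¹ ^ 3) / 12 := by
    rw [integral_Icc_eq_integral_Ioc, ← intervalIntegral.integral_of_le hac, intervalIntegral.integral_eq_sub_of_hasDerivAt hprim hcont4.intervalIntegrable]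
    ring
  rw [← hI4]
  refine setIntegral_mono_on ?_ ((hinv.pow 2).continuousOn.integrableOn_Icc) measurableSet_Icc hle
  rw [← uIcc_of_le hac]
  exact hcont4.integrableOn_Icc

/-! ## §2 The isotropic layer for an abstract non-negative `δ`-density -/

omit [NeZero L] in
/-- ★★ **TIP-MID AGAINST SHELL FROM A POINTWISE LAW WITHOUT THE SHELL LETTER, NO FUBINI.**  `F ≥ 0` on `Mid ∪ Icc a c`, `Mid ⊆ Ioi δ₁` measurable, `1 ≤ a < c ≤ δ₁`,
`R ≥ 0`, the law `F δt ≤ R·(1 + δt²)·F δs` (`δt ∈ Mid`, `δs ∈ Icc a c`, only `δs ≤ δt` asked) and `((1+δ²)⁻¹)²·F` integrable on `Icc a c`.  Then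
`∫_{Mid} ((1+δ²)⁻¹)²·F ≤ R/(δ₁·W′)·∫_{Icc a c} ((1+δ²)⁻¹)²·F`, `W′ = (c/(1+c²) − a/(1+a²) + (arctan c − arctan a))/2 ≥ (a⁻³ − c⁻³)/12 > 0`. [folklore] -/
theorem integral_mid_le_shell_of_pointwise' {F : ℝ → ℝ} {Mid : Set ℝ} (hMid : MeasurableSet Mid) {δ₁ : ℝ} (hMid₁ : Mid ⊆ Ioi δ₁)
    {a c : ℝ} (ha : 1 ≤ a) (hac : a < c) (hcδ : c ≤ δ₁) {R : ℝ} (hR : 0 ≤ R) (hF0 : ∀ δ ∈ Mid, 0 ≤ F δ) (hF0' : ∀ δ ∈ Icc a c, 0 ≤ F δ)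
    (H : ∀ δt ∈ Mid, ∀ δs ∈ Icc a c, δs ≤ δt → F δt ≤ R * (1 + δt ^ 2) * F δs)
    (hS : IntegrableOn (fun δ => ((1 + δ ^ 2)⁻¹) ^ 2 * F δ) (Icc a c)) :
    ∫ δ in Mid, ((1 + δ ^ 2)⁻¹) ^ 2 * F δ ≤
      R / (δ₁ * ((c / (1 + c ^ 2) - a / (1 + a ^ 2) + (Real.arctan c - Real.arctan a)) / 2)) * ∫ δ in Icc a c, ((1 + δ ^ 2)⁻¹) ^ 2 * F δ := by
  set W : ℝ := (c / (1 + c ^ 2) - a / (1 + a ^ 2) + (Real.arctan c - Real.arctan a)) / 2 with hW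
  set B : ℝ := ∫ δ in Icc a c, ((1 + δ ^ 2)⁻¹) ^ 2 * F δ with hB
  have hδ₁ : 0 < δ₁ := by linarith
  have hWint : W = ∫ x in Icc a c, ((1 + x ^ 2)⁻¹) ^ 2 := by rw [hW, integral_Icc_inv_one_add_sq_sq hac.le]
  have hW0 : 0 < W := by
    have hfl := integral_Icc_inv_one_add_sq_sq_ge ha hac.le
    rw [← hWint] at hfl
    have hlt : c⁻¹ < a⁻¹ := inv_strictAnti₀ (by linarith) hac
    have hc0 : 0 < c⁻¹ := inv_pos.2 (by linarith)
    have h3 : c⁻¹ ^ 3 < a⁻¹ ^ 3 := pow_lt_pow_left₀ hlt hc0.le (by norm_num)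
    linarith
  have hB0 : 0 ≤ B := by
    rw [hB]; exact setIntegral_nonneg measurableSet_Icc fun δ hδ => mul_nonneg (by positivity) (hF0' δ hδ)
  -- step 1: average the law over the shell letter against the bare tip weight
  have hstep : ∀ δt ∈ Mid, ((1 + δt ^ 2)⁻¹) ^ 2 * F δt * W ≤ R * (1 + δt ^ 2)⁻¹ * B := by
    intro δt hδt
    have ht1 : 0 < 1 + δt ^ 2 := by positivity
    have hpt : ∀ δs ∈ Icc a c, ((1 + δt ^ 2)⁻¹) ^ 2 * F δt * ((1 + δs ^ 2)⁻¹) ^ 2 ≤ R * (1 + δt ^ 2)⁻¹ * (((1 + δs ^ 2)⁻¹) ^ 2 * F δs) := by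
      intro δs hδs
      have h := H δt hδt δs hδs ((hδs.2.trans hcδ).trans (le_of_lt (hMid₁ hδt)))
      have e1 : ((1 + δt ^ 2)⁻¹) ^ 2 * F δt * ((1 + δs ^ 2)⁻¹) ^ 2 = ((1 + δt ^ 2)⁻¹) ^ 2 * ((1 + δs ^ 2)⁻¹) ^ 2 * F δt := by ring
      have e2 : R * (1 + δt ^ 2)⁻¹ * (((1 + δs ^ 2)⁻¹) ^ 2 * F δs) = ((1 + δt ^ 2)⁻¹) ^ 2 * ((1 + δs ^ 2)⁻¹) ^ 2 * (R * (1 + δt ^ 2) * F δs) := by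
        field_simp
      rw [e1, e2]
      exact mul_le_mul_of_nonneg_left h (by positivity)
    have hinv : Continuous fun x : ℝ => (1 + x ^ 2)⁻¹ :=
      Continuous.inv₀ (f := fun x : ℝ => 1 + x ^ 2) (by fun_prop) (fun x => by show (1 + x ^ 2 : ℝ) ≠ 0; positivity)
    have hintL : IntegrableOn (fun δs : ℝ => ((1 + δt ^ 2)⁻¹) ^ 2 * F δt * ((1 + δs ^ 2)⁻¹) ^ 2) (Icc a c) :=
      (continuous_const.mul (hinv.pow 2)).integrableOn_Icc
    have hintR : IntegrableOn (fun δs : ℝ => R * (1 + δt ^ 2)⁻¹ * (((1 + δs ^ 2)⁻¹) ^ 2 * F δs)) (Icc a c) := hS.const_mul _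
    have hmono := setIntegral_mono_on hintL hintR measurableSet_Icc hpt
    rw [integral_const_mul, integral_const_mul, ← hWint] at hmono
    exact hmono
  -- step 2: integrate the tip letter against `(1+δt²)⁻¹`
  have hpt2 : ∀ δt ∈ Mid, ((1 + δt ^ 2)⁻¹) ^ 2 * F δt ≤ (R * B / W) * (1 + δt ^ 2)⁻¹ := by
    intro δt hδt
    rw [show (R * B / W) * (1 + δt ^ 2)⁻¹ = R * (1 + δt ^ 2)⁻¹ * B / W by ring]
    exact (le_div_iff₀ hW0).2 (hstep δt hδt)
  have hintg : IntegrableOn (fun δt : ℝ => (R * B / W) * (1 + δt ^ 2)⁻¹) Mid := (integrable_inv_one_add_sq.const_mul _).integrableOn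
  have hmono2 : ∫ δ in Mid, ((1 + δ ^ 2)⁻¹) ^ 2 * F δ ≤ ∫ δ in Mid, (R * B / W) * (1 + δ ^ 2)⁻¹ := by
    refine integral_mono_of_nonneg ?_ hintg ?_
    · filter_upwards [ae_restrict_mem hMid] with δ hδ using mul_nonneg (by positivity) (hF0 δ hδ)
    · filter_upwards [ae_restrict_mem hMid] with δ hδ using hpt2 δ hδ
  rw [integral_const_mul] at hmono2
  have htail := setIntegral_inv_one_add_sq_le_inv hδ₁ hMid₁
  calc ∫ δ in Mid, ((1 + δ ^ 2)⁻¹) ^ 2 * F δ ≤ R * B / W * ∫ δ in Mid, (1 + δ ^ 2)⁻¹ := hmono2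
    _ ≤ R * B / W * δ₁⁻¹ := mul_le_mul_of_nonneg_left htail (by positivity)
    _ = R / (δ₁ * W) * B := by field_simp

/-! ## §3 The isotropic layer for the Morse–Bott plane mass -/

/-- ★★ **TIP-MID AGAINST SHELL FOR THE MORSE–BOTT PLANE MASS, ISOTROPIC TWIN** (w2 g61's p-uniform (H″): `𝔪(hubAt δt 1, ε, p) ≤ R·(1+δt²)·𝔪(hubAt δs 1, ε, p)` on `Box`,
ends included).  Windows `Mid ⊆ Ioi δ₁`, `Icc a c` with `1 ≤ a < c ≤ δ₁`, measurable `Box`, `R ≥ 0`; then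
`∫_{Mid}((1+δ²)⁻¹)²·∫_{Box}𝔪(hubAt δ 1) ≤ R/(δ₁·W′)·∫_{Icc a c}((1+δ²)⁻¹)²·∫_{Box}𝔪(hubAt δ 1)`, `W′ = (c/(1+c²) − a/(1+a²) + (arctan c − arctan a))/2`. [folklore] -/
theorem tipMid_le_shell_of_pointwise' (ε : GnoSign L) {Mid : Set ℝ} (hMid : MeasurableSet Mid) {δ₁ : ℝ} (hMid₁ : Mid ⊆ Ioi δ₁)
    {a c : ℝ} (ha : 1 ≤ a) (hac : a < c) (hcδ : c ≤ δ₁) {Box : Set (ℝ × ℝ)} (hBox : MeasurableSet Box) {R : ℝ} (hR : 0 ≤ R)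
    (H : ∀ δt ∈ Mid, ∀ δs ∈ Icc a c, δs ≤ δt → ∀ p ∈ Box,
      mbDensity (L := L) (hubAt δt 1) ε p ≤ R * (1 + δt ^ 2) * mbDensity (L := L) (hubAt δs 1) ε p)
    (hInt : ∀ δs ∈ Icc a c, IntegrableOn (fun p : ℝ × ℝ => mbDensity (L := L) (hubAt δs 1) ε p) Box)
    (hS : IntegrableOn (fun δ : ℝ => ((1 + δ ^ 2)⁻¹) ^ 2 * ∫ p in Box, mbDensity (L := L) (hubAt δ 1) ε p) (Icc a c)) :
    ∫ δ in Mid, ((1 + δ ^ 2)⁻¹) ^ 2 * ∫ p in Box, mbDensity (L := L) (hubAt δ 1) ε p ≤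
      R / (δ₁ * ((c / (1 + c ^ 2) - a / (1 + a ^ 2) + (Real.arctan c - Real.arctan a)) / 2)) *
        ∫ δ in Icc a c, ((1 + δ ^ 2)⁻¹) ^ 2 * ∫ p in Box, mbDensity (L := L) (hubAt δ 1) ε p := by
  have hF0 : ∀ δ : ℝ, 0 ≤ ∫ p in Box, mbDensity (L := L) (hubAt δ 1) ε p := fun δ =>
    integral_nonneg fun p => mbDensity_nonneg _ ε p
  refine integral_mid_le_shell_of_pointwise' hMid hMid₁ ha hac hcδ hR (fun δ _ => hF0 δ) (fun δ _ => hF0 δ) (fun δt hδt δs hδs hle => ?_) hS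
  -- integrate (H″) over `p ∈ Box`
  by_cases hIt : IntegrableOn (fun p : ℝ × ℝ => mbDensity (L := L) (hubAt δt 1) ε p) Box
  · have h2 : R * (1 + δt ^ 2) * ∫ p in Box, mbDensity (L := L) (hubAt δs 1) ε p = ∫ p in Box, R * (1 + δt ^ 2) * mbDensity (L := L) (hubAt δs 1) ε p :=
      (integral_const_mul _ _).symm
    rw [h2]
    exact setIntegral_mono_on hIt ((hInt δs hδs).const_mul _) hBox (fun p hp => H δt hδt δs hδs hle p hp)
  · rw [integral_undef hIt]
    exact mul_nonneg (mul_nonneg hR (by positivity)) (hF0 δs)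

end Summit.QuantumFields.YangMills.Theorems.SwapVirialDeficit.SectorLaplace

end
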